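import Summits.CriticalPhenomena.CardyFormulaZ2.Theorems.CardyWhiteToColouredNoiseDiscretisationTail

/-!
# The white-noise coupling of the lattice model (stub `coupling` of `NoiseDiscretisation`)

Helper file for item `NoiseDiscretisation` (stmt-CriticalPhenomena-4598) of route
`CardyWhiteToColoured` (`CardyFormulaZ2`). We construct, for every mesh `δ > 0`, a measurable map
`Ξ_δ : 𝒮'(ℂ) → (E(ℤ²) → ℝ)` pushing any white noise `μ` to the lattice white noise (i.i.d. `N(0,1)`
on the edges of `ℤ²`), `Ξ_δ(ω)_e = ω(H_e)/N` with `H_e` the smooth bump of the medial cell of `e`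
(`Cells`) and `N = ‖H_e‖_{L²}`, together with constants `c_δ = N > 0`, such that for every conformal
rectangle `R` and `η > 0` the probability that some inner edge `e` of `R` at mesh `δ` has
`|c_δ · (smoothed lattice noise at m_δ(e)) − (smoothed continuum noise at m_δ(e))| ≥ η` tends to
`0` as `δ → 0⁺` (`coupling`): per edge the Gaussian tail `2 exp(−η²/(8(27δ² + 120δℓ)))`
(`measureReal_discrepancy_ge_le` with `θ = δ/ℓ`), and at most `2(2ρ/δ + 3)²` inner edges
(`R ⊆ B̄(0, ρ)`).

References: S. Muirhead, H. Vanneuville, Ann. Inst. H. Poincaré Probab. Stat. 56 (2020), §2.1, §3.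
-/

noncomputable section

namespace Summit.CriticalPhenomena.CardyFormulaZ2.Theorems

namespace WhiteToColoured

open Set Metric MeasureTheory Filter Topology Real ENNReal Finset ProbabilityTheory
open Literature.Probability.LatticeModels Literature.Probability.Percolation
open Literature.Probability.RandomPlanarGeometry
open Literature.MathematicalPhysics.QuantumLattice

/-- `Dg[w] = max |Re w + Im w| |Re w − Im w| = |Re w| + |Im w|`, the rotated sup-distance. -/
local notation3 "Dg[" w "]" => max |Complex.re w + Complex.im w| |Complex.re w - Complex.im w|

/-- The value `hB[β, m, z] = β (p (z − m)) · β (q (z − m))` of the cell bump built from a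
one-dimensional bump `β` and centred at `m`. -/
local notation3 "hB[" β ", " m ", " z "]" =>
  (β : ℝ → ℝ) (Complex.re (z - m) + Complex.im (z - m)) * β (Complex.re (z - m) - Complex.im (z - m))

/-- `InnerE[Ω, δ]`: the inner lattice edges at mesh `δ` (both mesh end-points in `Ω`). -/
local notation3 "InnerE[" Ω ", " δ "]" =>
  {e : Sym2 (Site 2) | e ∈ (zdGraph 2).edgeSet ∧ ∀ v ∈ e, meshPoint δ v ∈ (Ω : Set ℂ)}

/-! ### Counting the inner edges -/

/-- **The inner edges of a bounded set form a finite set of controlled size**: if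
`Ω ⊆ B̄(0, ρ)` then at mesh `0 < δ` there is a finite set of at most `2 (2ρ/δ + 3)²` edges containing
all inner edges. -/
theorem exists_finset_innerE_subset {Ω : Set ℂ} {ρ : ℝ} (hρ : 0 ≤ ρ) (hΩ : Ω ⊆ closedBall (0 : ℂ) ρ)
    {δ : ℝ} (hδ : 0 < δ) :
    ∃ I : Finset (Sym2 (Site 2)), InnerE[Ω, δ] ⊆ ↑I ∧ (I.card : ℝ) ≤ 2 * (2 * ρ / δ + 3) ^ 2 := by
  classical
  set M : ℤ := ⌈ρ / δ⌉ with hM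
  have hM0 : (0 : ℤ) ≤ M := Int.ceil_nonneg (by positivity)
  set T : Finset (Site 2) := Fintype.piFinset fun _ : Fin 2 => Finset.Icc (-M) M with hT
  set I : Finset (Sym2 (Site 2)) :=
    (T ×ˢ (Finset.univ : Finset (Fin 2))).image fun p => s(p.1, p.1 + Pi.single p.2 1) with hI
  refine ⟨I, ?_, ?_⟩
  · rintro e ⟨he, hin⟩
    obtain ⟨u, i, rfl⟩ := mem_edgeSet_zdGraph_iff.1 he
    have hu : meshPoint δ u ∈ Ω := hin u (Sym2.mem_mk_left _ _)
    have hub := hΩ hu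
    rw [mem_closedBall, dist_zero_right] at hub
    refine Finset.mem_image.2 ⟨(u, i), Finset.mem_product.2 ⟨?_, Finset.mem_univ _⟩, rfl⟩
    rw [hT, Fintype.mem_piFinset]
    intro j
    rw [Finset.mem_Icc]
    have hcoord : |δ * (u j : ℝ)| ≤ ρ := by
      fin_cases j
      · have := (Complex.abs_re_le_norm _).trans hub
        rwa [meshPoint_re] at this
      · have := (Complex.abs_im_le_norm _).trans hub
        rwa [meshPoint_im] at this
    rw [abs_mul, abs_of_pos hδ] at hcoord
    have h1 : |(u j : ℝ)| ≤ ρ / δ := by rwa [le_div_iff₀ hδ, mul_comm]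
    have h2 : ((|u j| : ℤ) : ℝ) ≤ M := by
      rw [Int.cast_abs]; exact h1.trans (Int.le_ceil _)
    have h3 : |u j| ≤ M := by exact_mod_cast h2
    have h4 := abs_le.1 h3
    show -M ≤ u j ∧ u j ≤ M
    exact ⟨h4.1, h4.2⟩
  · have hcard : I.card ≤ T.card * 2 := by
      refine (Finset.card_image_le).trans ?_
      rw [Finset.card_product, Finset.card_univ, Fintype.card_fin]
    have hT' : T.card = (Finset.Icc (-M) M).card ^ 2 := by
      rw [hT, Fintype.card_piFinset, Finset.prod_const, Finset.card_univ, Fintype.card_fin]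
    rw [Int.card_Icc] at hT'
    have hMle : (M : ℝ) ≤ ρ / δ + 1 := by
      have := Int.ceil_lt_add_one (ρ / δ)
      rw [← hM] at this
      exact this.le
    have htn : ((M + 1 - -M).toNat : ℝ) = 2 * M + 1 := by
      have : (0 : ℤ) ≤ M + 1 - -M := by omega
      rw [show ((M + 1 - -M).toNat : ℝ) = (((M + 1 - -M).toNat : ℤ) : ℝ) by norm_cast,
        Int.toNat_of_nonneg this]
      push_cast; ring
    calc (I.card : ℝ) ≤ (T.card * 2 : ℕ) := by exact_mod_cast hcard
      _ = ((2 * M + 1) ^ 2) * 2 := by rw [hT']; push_cast; rw [htn]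
      _ ≤ 2 * (2 * ρ / δ + 3) ^ 2 := by
          have h2 : 2 * ρ / δ = 2 * (ρ / δ) := by ring
          have : (2 * (M : ℝ) + 1) ≤ 2 * ρ / δ + 3 := by rw [h2]; linarith
          have h0 : 0 ≤ 2 * (M : ℝ) + 1 := by positivity
          nlinarith

/-! ### The coupling at a fixed mesh -/

section

variable {μ : Measure (FieldConfig ℂ)} {k : ℝ → ℂ → SchwartzMap ℂ ℝ} {ℓ : ℝ}

/-- **The coupling at a fixed mesh `δ > 0`.** See the module docstring; the tail estimate is
asserted for `δ ≤ min 1 (ℓ/2)` (the only meshes that matter for the limit `δ → 0⁺`). -/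
theorem exists_coupling_at (hμ : IsWhiteNoise μ) (hk : IsGaussianBumpFamily k) (hℓ : 0 < ℓ)
    {Ω : Set ℂ} {ρ : ℝ} (hρ : 0 ≤ ρ) (hΩ : Ω ⊆ closedBall (0 : ℂ) ρ) {δ : ℝ} (hδ : 0 < δ) :
    ∃ (Ξ : FieldConfig ℂ → ((zdGraph 2).edgeSet → ℝ)) (c : ℝ), Measurable Ξ ∧
      μ.map Ξ = latticeWhiteNoise ∧ 0 < c ∧
      ∀ η : ℝ, 0 < η → δ ≤ ℓ / 2 → δ ≤ 1 →
        μ.real {ω | ∃ e ∈ InnerE[Ω, δ],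
          η ≤ |c * smoothedNoise ℓ δ (Ξ ω) (medialPoint δ e) - ω (k ℓ (medialPoint δ e))|} ≤
        2 * (2 * ρ / δ + 3) ^ 2 * (2 * Real.exp (-η ^ 2 / (8 * (27 * δ ^ 2 + 120 * δ * ℓ)))) := by
  haveI := wn_isProbabilityMeasure hμ
  -- the margin parameter
  set θ : ℝ := min (δ / ℓ) (1 / 2) with hθ
  have hθ0 : 0 < θ := lt_min (by positivity) (by norm_num)
  have hθ1 : θ < 1 := (min_le_right _ _).trans_lt (by norm_num)
  -- the one-dimensional bump
  have hr₁ : 0 < (1 - θ) * δ / 2 := by nlinarith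
  have hr₁₂ : (1 - θ) * δ / 2 < (1 - θ / 2) * δ / 2 := by nlinarith
  obtain ⟨β, hβ, hβ1', hβ0, hβp, hβ1⟩ := exists_bump hr₁ hr₁₂
  -- the Schwartz cell bumps and their normalisation
  set H : (zdGraph 2).edgeSet → SchwartzMap ℂ ℝ := fun e =>
    (hB_hasCompactSupport hβ0 (medialPoint δ e.1)).toSchwartzMap (hB_contDiff hβ _) with hHdef
  have hH : ∀ e z, H e z = hB[β, medialPoint δ e.1, z] := fun e z => rfl
  set N2 : ℝ := ∫ z, hB[β, 0, z] ^ 2 with hN2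
  have hN2pos : 0 < N2 := integral_hB_sq_pos hβ hβ1' hβ0 hr₁
  set N : ℝ := Real.sqrt N2 with hN
  have hNpos : 0 < N := Real.sqrt_pos.2 hN2pos
  have hNsq : N ^ 2 = N2 := Real.sq_sqrt hN2pos.le
  set g : (zdGraph 2).edgeSet → SchwartzMap ℂ ℝ := fun e => N⁻¹ • H e with hg
  have hg_apply : ∀ e z, g e z = N⁻¹ * hB[β, medialPoint δ e.1, z] := fun e z => by
    rw [hg, smul_apply, smul_eq_mul, hH]
  -- orthonormality
  have hsep : ∀ e e' : (zdGraph 2).edgeSet, e ≠ e' →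
      (1 - θ / 2) * δ / 2 + (1 - θ / 2) * δ / 2 ≤ Dg[medialPoint δ e.1 - medialPoint δ e'.1] := by
    intro e e' hne
    have := le_dg_medialPoint_sub hδ e.2 e'.2 fun h => hne (Subtype.ext h)
    nlinarith
  have horth : ∀ e e' : (zdGraph 2).edgeSet, e ≠ e' → ∫ z, g e z * g e' z = 0 := by
    intro e e' hne
    simp_rw [hg_apply]
    have : (fun z => N⁻¹ * hB[β, medialPoint δ e.1, z] * (N⁻¹ * hB[β, medialPoint δ e'.1, z])) =
        fun z => N⁻¹ * N⁻¹ * (hB[β, medialPoint δ e.1, z] * hB[β, medialPoint δ e'.1, z]) := by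
      funext z; ring
    rw [this, integral_const_mul, integral_hB_mul_hB hβ0 (hsep e e' hne), mul_zero]
  have hnorm : ∀ e : (zdGraph 2).edgeSet, ∫ z, g e z ^ 2 = 1 := by
    intro e
    simp_rw [hg_apply]
    have : (fun z => (N⁻¹ * hB[β, medialPoint δ e.1, z]) ^ 2) =
        fun z => N⁻¹ ^ 2 * hB[β, medialPoint δ e.1, z] ^ 2 := by funext z; ring
    rw [this, integral_const_mul, integral_hB_sq (β := β) (medialPoint δ e.1), ← hN2, ← hNsq]
    field_simp
  -- the coupling map
  set Ξ : FieldConfig ℂ → ((zdGraph 2).edgeSet → ℝ) := fun ω e => ω (g e) with hΞ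
  have hΞm : Measurable Ξ := measurable_pi_lambda _ fun e => measurable_eval (g e)
  have hlaw : μ.map Ξ = latticeWhiteNoise := wn_map_pi_eval_eq_infinitePi hμ g horth hnorm
  refine ⟨Ξ, N, hΞm, hlaw, hNpos, fun η hη hδℓ2 hδ1 => ?_⟩
  have hδℓ : δ ≤ ℓ := by linarith
  have hθeq : θ = δ / ℓ := min_eq_left (by rw [div_le_iff₀ hℓ]; linarith)
  -- the rescaled smoothed lattice noise is the series `∑' K(x - m_e) ω(H e)`
  have hseries : ∀ (ω : FieldConfig ℂ) (x : ℂ), N * smoothedNoise ℓ δ (Ξ ω) x =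
      ∑' e : (zdGraph 2).edgeSet, gaussWeight ℓ (x - medialPoint δ e.1) * ω (H e) := by
    intro ω x
    rw [smoothedNoise_eq_tsum_gaussWeight, ← tsum_mul_left]
    refine tsum_congr fun e => ?_
    show N * (gaussWeight ℓ (x - medialPoint δ e.1) * ω (g e)) = _
    rw [hg, map_smul, smul_eq_mul]
    field_simp
  -- per-edge tail
  have htail : ∀ e : Sym2 (Site 2), μ.real {ω : FieldConfig ℂ |
      η ≤ |N * smoothedNoise ℓ δ (Ξ ω) (medialPoint δ e) - ω (k ℓ (medialPoint δ e))|} ≤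
      2 * Real.exp (-η ^ 2 / (8 * (27 * δ ^ 2 + 120 * δ * ℓ))) := by
    intro e
    have h := measureReal_discrepancy_ge_le hμ hℓ hδ hδℓ hθ0 hθ1 hβ hβ1' hβ0 hβp hβ1 hH hk
      (medialPoint δ e) hη
    have hvv : 120 * θ * ℓ ^ 2 = 120 * δ * ℓ := by rw [hθeq]; field_simp
    rw [hvv] at h
    have hset : {ω : FieldConfig ℂ |
        η ≤ |N * smoothedNoise ℓ δ (Ξ ω) (medialPoint δ e) - ω (k ℓ (medialPoint δ e))|} =
        {ω : FieldConfig ℂ | η ≤ |(∑' e' : (zdGraph 2).edgeSet,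
          gaussWeight ℓ (medialPoint δ e - medialPoint δ e'.1) * ω (H e')) - ω (k ℓ (medialPoint δ e))|} := by
      ext ω
      simp only [mem_setOf_eq, hseries]
    rw [hset]
    exact h
  -- union over the inner edges
  obtain ⟨I, hI, hIcard⟩ := exists_finset_innerE_subset hρ hΩ hδ
  have hsub : {ω : FieldConfig ℂ | ∃ e ∈ InnerE[Ω, δ],
      η ≤ |N * smoothedNoise ℓ δ (Ξ ω) (medialPoint δ e) - ω (k ℓ (medialPoint δ e))|} ⊆
      ⋃ e ∈ I, {ω : FieldConfig ℂ |
        η ≤ |N * smoothedNoise ℓ δ (Ξ ω) (medialPoint δ e) - ω (k ℓ (medialPoint δ e))|} := by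
    rintro ω ⟨e, he, hωe⟩
    exact mem_biUnion (hI he) hωe
  calc μ.real {ω : FieldConfig ℂ | ∃ e ∈ InnerE[Ω, δ],
        η ≤ |N * smoothedNoise ℓ δ (Ξ ω) (medialPoint δ e) - ω (k ℓ (medialPoint δ e))|}
      ≤ μ.real (⋃ e ∈ I, {ω : FieldConfig ℂ |
          η ≤ |N * smoothedNoise ℓ δ (Ξ ω) (medialPoint δ e) - ω (k ℓ (medialPoint δ e))|}) :=
        measureReal_mono hsub (measure_ne_top _ _)
    _ ≤ ∑ e ∈ I, μ.real {ω : FieldConfig ℂ |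
          η ≤ |N * smoothedNoise ℓ δ (Ξ ω) (medialPoint δ e) - ω (k ℓ (medialPoint δ e))|} :=
        measureReal_biUnion_finset_le _ _
    _ ≤ ∑ _e ∈ I, 2 * Real.exp (-η ^ 2 / (8 * (27 * δ ^ 2 + 120 * δ * ℓ))) :=
        Finset.sum_le_sum fun e _ => htail e
    _ = I.card * (2 * Real.exp (-η ^ 2 / (8 * (27 * δ ^ 2 + 120 * δ * ℓ)))) := by
        rw [Finset.sum_const, nsmul_eq_mul]
    _ ≤ 2 * (2 * ρ / δ + 3) ^ 2 * (2 * Real.exp (-η ^ 2 / (8 * (27 * δ ^ 2 + 120 * δ * ℓ)))) := by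
        gcongr

end

/-! ### The asymptotics of the bound -/

/-- `(2ρ/δ + 3)² exp(−a/δ) → 0` as `δ → 0⁺` (`a > 0`). -/
theorem tendsto_bound_zero {ρ a : ℝ} (hρ : 0 ≤ ρ) (ha : 0 < a) :
    Tendsto (fun δ : ℝ => 2 * (2 * ρ / δ + 3) ^ 2 * (2 * Real.exp (-a / δ))) (𝓝[>] 0) (𝓝 0) := by
  -- `u² e^{-a u} → 0` as `u → ∞`
  have h1 : Tendsto (fun u : ℝ => (a * u) ^ 2 * Real.exp (-(a * u))) atTop (𝓝 0) :=
    (Real.tendsto_pow_mul_exp_neg_atTop_nhds_zero 2).comp (tendsto_id.const_mul_atTop ha)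
  have h2 : Tendsto (fun u : ℝ => u ^ 2 * Real.exp (-(a * u))) atTop (𝓝 0) := by
    have := h1.const_mul (a⁻¹ ^ 2)
    rw [mul_zero] at this
    refine this.congr' (Eventually.of_forall fun u => ?_)
    field_simp
  have h3 : Tendsto (fun δ : ℝ => (δ⁻¹) ^ 2 * Real.exp (-(a * δ⁻¹))) (𝓝[>] 0) (𝓝 0) :=
    h2.comp tendsto_inv_nhdsGT_zero
  -- the bound is at most `16 (2ρ + 3)² · δ⁻² e^{-a/δ}` for `δ ≤ 1`
  have h4 : Tendsto (fun δ : ℝ => 4 * (2 * ρ + 3) ^ 2 * ((δ⁻¹) ^ 2 * Real.exp (-(a * δ⁻¹))))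
      (𝓝[>] 0) (𝓝 0) := by
    have := h3.const_mul (4 * (2 * ρ + 3) ^ 2)
    rwa [mul_zero] at this
  have hev : ∀ᶠ δ in 𝓝[>] (0 : ℝ), δ ≤ 1 ∧ 0 < δ := by
    filter_upwards [self_mem_nhdsWithin, Ioo_mem_nhdsGT one_pos] with δ hδ hδ1
    exact ⟨hδ1.2.le, hδ⟩
  refine tendsto_of_tendsto_of_tendsto_of_le_of_le' tendsto_const_nhds h4 ?_ ?_
  · filter_upwards [hev] with δ hδ
    positivity
  · filter_upwards [hev] with δ ⟨hδ1, hδ0⟩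
    have hexp : Real.exp (-a / δ) = Real.exp (-(a * δ⁻¹)) := by congr 1; field_simp
    rw [hexp]
    have hb : (2 * ρ / δ + 3) ^ 2 ≤ (2 * ρ + 3) ^ 2 * δ⁻¹ ^ 2 := by
      rw [← mul_pow]
      apply pow_le_pow_left₀ (by positivity)
      rw [show (2 * ρ + 3) * δ⁻¹ = 2 * ρ / δ + 3 / δ by field_simp]
      have : (3 : ℝ) ≤ 3 / δ := by rw [le_div_iff₀ hδ0]; nlinarith
      linarith
    have hpos : 0 ≤ Real.exp (-(a * δ⁻¹)) := (Real.exp_pos _).le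
    nlinarith [mul_le_mul_of_nonneg_right hb hpos]

section

variable {μ : Measure (FieldConfig ℂ)} {k : ℝ → ℂ → SchwartzMap ℂ ℝ} {ℓ : ℝ}

/-- **The coupling stub of `NoiseDiscretisation`.** For a white noise `μ`, a Gaussian bump family
`k`, `ℓ > 0` and a conformal rectangle `R`: a family of measurable maps `Ξ_δ` pushing `μ` to the
lattice white noise and constants `c_δ > 0` such that the probability of an `η`-discrepancy on some
inner edge between `c_δ ·` the smoothed lattice noise (of `Ξ_δ ω`) and the smoothed continuum noise
(of `ω`) tends to `0` as `δ → 0⁺`. -/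
theorem coupling (hμ : IsWhiteNoise μ) (hk : IsGaussianBumpFamily k) (hℓ : 0 < ℓ)
    (R : ConformalRectangle) :
    ∃ Ξ : ℝ → FieldConfig ℂ → ((zdGraph 2).edgeSet → ℝ),
      (∀ δ, 0 < δ → Measurable (Ξ δ)) ∧ (∀ δ, 0 < δ → μ.map (Ξ δ) = latticeWhiteNoise) ∧
      ∃ c : ℝ → ℝ, (∀ δ, 0 < δ → 0 < c δ) ∧ ∀ η : ℝ, 0 < η →
        Tendsto (fun δ => μ {ω | ∃ e ∈ InnerE[R.carrier, δ],
          η ≤ |c δ * smoothedNoise ℓ δ (Ξ δ ω) (medialPoint δ e) - ω (k ℓ (medialPoint δ e))|})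
          (𝓝[>] 0) (𝓝 0) := by
  classical
  haveI := wn_isProbabilityMeasure hμ
  obtain ⟨ρ, hΩρ⟩ := (Metric.isBounded_iff_subset_closedBall (0 : ℂ)).1 R.isBounded
  set ρ' := max ρ 0 with hρ'
  have hρ'0 : 0 ≤ ρ' := le_max_right _ _
  have hΩ : R.carrier ⊆ closedBall (0 : ℂ) ρ' := hΩρ.trans (closedBall_subset_closedBall (le_max_left _ _))
  choose Ξ c hΞ using fun (δ : ℝ) (hδ : 0 < δ) => exists_coupling_at hμ hk hℓ hρ'0 hΩ hδ
  refine ⟨fun δ => if h : 0 < δ then Ξ δ h else fun _ _ => 0, fun δ hδ => ?_, fun δ hδ => ?_,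
    fun δ => if h : 0 < δ then c δ h else 1, fun δ hδ => ?_, fun η hη => ?_⟩
  · simp only [dif_pos hδ]; exact (hΞ δ hδ).1
  · simp only [dif_pos hδ]; exact (hΞ δ hδ).2.1
  · simp only [dif_pos hδ]; exact (hΞ δ hδ).2.2.1
  · -- the bound and its limit
    set b : ℝ → ℝ := fun δ => 2 * (2 * ρ' / δ + 3) ^ 2 *
      (2 * Real.exp (-(η ^ 2 / (8 * 147 * ℓ)) / δ)) with hb
    have hbt : Tendsto b (𝓝[>] 0) (𝓝 0) := tendsto_bound_zero hρ'0 (by positivity)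
    have hbt' : Tendsto (fun δ => ENNReal.ofReal (b δ)) (𝓝[>] 0) (𝓝 0) := by
      have := ENNReal.tendsto_ofReal hbt
      rwa [ENNReal.ofReal_zero] at this
    have hev : ∀ᶠ δ in 𝓝[>] (0 : ℝ), 0 < δ ∧ δ ≤ min 1 (ℓ / 2) := by
      filter_upwards [self_mem_nhdsWithin, Ioo_mem_nhdsGT (show (0 : ℝ) < min 1 (ℓ / 2) by positivity)]
        with δ hδ hδ1
      exact ⟨hδ, hδ1.2.le⟩
    refine tendsto_of_tendsto_of_tendsto_of_le_of_le' tendsto_const_nhds hbt'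
      (Eventually.of_forall fun _ => zero_le) ?_
    filter_upwards [hev] with δ ⟨hδ, hδ'⟩
    have hδ1 : δ ≤ 1 := hδ'.trans (min_le_left _ _)
    have hδℓ2 : δ ≤ ℓ / 2 := hδ'.trans (min_le_right _ _)
    simp only [dif_pos hδ]
    rw [← ofReal_measureReal (measure_ne_top _ _)]
    apply ENNReal.ofReal_le_ofReal
    refine ((hΞ δ hδ).2.2.2 η hη hδℓ2 hδ1).trans ?_
    have hexp : Real.exp (-η ^ 2 / (8 * (27 * δ ^ 2 + 120 * δ * ℓ))) ≤
        Real.exp (-(η ^ 2 / (8 * 147 * ℓ)) / δ) := by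
      apply Real.exp_le_exp.2
      have hvpos : 0 < 8 * (27 * δ ^ 2 + 120 * δ * ℓ) := by positivity
      have hv : 8 * (27 * δ ^ 2 + 120 * δ * ℓ) ≤ 8 * 147 * ℓ * δ := by nlinarith
      rw [neg_div, neg_div, neg_le_neg_iff, div_div]
      exact div_le_div_of_nonneg_left (sq_nonneg η) hvpos hv
    have hc0 : 0 ≤ 2 * (2 * ρ' / δ + 3) ^ 2 := by positivity
    show _ ≤ 2 * (2 * ρ' / δ + 3) ^ 2 * (2 * Real.exp (-(η ^ 2 / (8 * 147 * ℓ)) / δ))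
    exact mul_le_mul_of_nonneg_left (by linarith) hc0

end

end WhiteToColoured

end Summit.CriticalPhenomena.CardyFormulaZ2.Theorems
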